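import Mathlib.Analysis.SpecialFunctions.Pow.Real
import Mathlib.Analysis.Complex.Norm
import Mathlib.Topology.MetricSpace.Basic
import Mathlib.Topology.MetricSpace.Lipschitz
import Mathlib.MeasureTheory.Measure.Lebesgue.EqHaar
import Mathlib.MeasureTheory.Group.Measure
import Mathlib.MeasureTheory.Group.Prod
import Mathlib.MeasureTheory.Measure.Haar.Basic
import Literature.Geometry.MetricEmbeddings.HeisenbergL1Proofs
import Literature.NumberTheory.Sieve.LinearEquationsInPrimesHeisenbergNilmanifold
import HarnessLib

/-!
# The continuous Heisenberg group `ℍ = ℍ(ℝ)`: group law, dilations, the Cygan–Korányi metric,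
# Haar measure, and the integer lattice `ℍ(ℤ)`

Family `pnp`, layer `Literature/Geometry/MetricEmbeddings`. The ambient group of the transport
argument of J. Cheeger, B. Kleiner, A. Naor, *Compression bounds for Lipschitz maps from the
Heisenberg group to `L₁`*, Acta Math. 207 (2011) = arXiv:0910.2026, §1.1 (arXiv p. 5): "We will
view `ℍ` as `ℝ³` equipped with the noncommutative product […]. From the multiplication formula,
it follows directly that for `R > 0`, the map `A_R : ℝ³ → ℝ³` defined by
`A_R((a,b,c)) = (Ra, Rb, R²c)` is an automorphism of `ℍ`. It is also a homothety of the metric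
`d^ℍ`. The discrete Heisenberg group, `ℍ(ℤ)`, is the integer lattice `ℤ³` […] equipped with the
above product. It is a discrete cocompact subgroup of `ℍ`."

## Design

* `HeisK` is a TYPE SYNONYM of `Literature.NumberTheory.Sieve.Heis` — the Heisenberg group
  `H³(ℝ)` of the Green–Tao nilmanifold file (polarized / upper-triangular law
  `(x,y,z)·(x',y',z') = (x+x', y+y', z+z'+xy')`), which carries the EUCLIDEAN metric of `ℝ³`;
  the synonym re-uses that group verbatim (`inferInstanceAs`, `HeisK.toHeis : HeisK ≃* Heis` is
  the identity) and carries the Cygan–Korányi metric instead (design as for `WithLp`). The integer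
  points form a subgroup which is LITERALLY the carrier `ℤ × ℤ × ℤ, heisMul` of
  `HeisenbergL1.lean` (`HeisK.ofInt`, `HeisK.ofInt_heisMul`) and is the lattice `Heis.latticeΓ`
  of the nilmanifold file (`HeisK.toHeis_ofInt_mem_latticeΓ`). [CKN] print the isomorphic
  symmetric law `c+c'+ab'−ba'`; the coordinate change is `(a,b,c) = (x, y, 2z − xy)`.
* The metric is the **Cygan–Korányi metric** `d_K(p,q) = ‖p⁻¹q‖_K` with the gauge
  `‖(x,y,z)‖_K = ((x²+y²)² + 4(2z−xy)²)^{1/4}` (`HeisK.gauge`, written `√√·`): in the coordinates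
  `w = x+iy`, `t = −2(2z−xy)` this is Cygan's homogeneous norm `(|w|⁴+t²)^{1/4}`, whose
  subadditivity `‖pq‖_K ≤ ‖p‖_K + ‖q‖_K` is J. Cygan, Proc. AMS 83 (1981) 69–70 (PROVED here,
  `HeisK.gauge_mul_le`, by Cygan's identity `|w_{pq}|² + it_{pq} = (|w_p|²+it_p) + (|w_q|²+it_q) +
  2 w_p w̄_q`). It is left-invariant (`HeisK.dist_mul_left`) and the dilations `δ_s` are homotheties
  (`HeisK.dist_dilate`); `d_K` is bi-Lipschitz equivalent to the Carnot–Carathéodory metric `d^ℍ` of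
  [CKN] (not defined here), so every statement of [CKN §1] that is invariant under bi-Lipschitz
  change of metric may be read with `d_K`.
* Topology and measure: the coordinates `x, y` are `1`-Lipschitz and `z` is continuous for `d_K`,
  and the gauge is a continuous function of the coordinates, so `HeisK.homeomorphProd : ℍ ≃ₜ ℝ³` and `HeisK.toHeisHomeomorph`
  (the Cygan–Korányi metric induces the Euclidean topology) and `ℍ` is a topological group
  (`IsTopologicalGroup HeisK`); `ℍ` carries the Borel σ-algebra and **Haar measure = Lebesgue
  measure `dx dy dz`** (`MeasureSpace HeisK`, `HeisK.volume_eq`, `HeisK.measurePreserving_equivProd`):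
  left translations are shears followed by translations in coordinates, hence volume preserving
  (`HeisK.measurePreserving_mul_left`, instance `IsMulLeftInvariant`), and with finiteness on
  compacts / positivity on opens transported along the homeomorphism, `volume` is a Haar
  measure (`IsHaarMeasure`), as required to read "with respect to Haar measure, for at least half
  of the points `x ∈ B_{1/2}(p)`" in [CKN Thm. 1.1].
* `HeisK.exists_ofInt_dist_le`: every point of `ℍ` is within `d_K`-distance `3` of the lattice
  (cocompactness in the form used on arXiv p. 6: "there exist `a, b ∈ ℤ³` such that
  `d^ℍ(a,x) ≲ 1`"); `HeisK.one_le_gauge_ofInt`: the lattice is discrete.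
* `HeisK.dist_ofInt_le`, `HeisK.dist_le_dist_ofInt`: on the lattice `d_K ≤ 3 d_W` and
  `d_W ≤ 20 d_K` for the word metric `d_W = cayleyGraph.dist` of `HeisenbergL1.lean` — the
  bi-Lipschitz equivalence "`d_T ≍ d^ℍ` on an orbit, see [BBI]" of [CKN §1.1] with explicit
  constants (via the ball–box bounds of `HeisenbergL1Proofs.lean`).

Not here: the Carnot–Carathéodory metric (bi-Lipschitz to `d_K`), the scaling
`vol(δ_s E) = s⁴ vol(E)`, the Lie algebra, the negative type property of Lee–Naor,
higher-dimensional Heisenberg groups, Lipschitz extension from the lattice.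

## References

* [CheegerKleinerNaor2011] J. Cheeger, B. Kleiner, A. Naor, Acta Math. 207 (2011), §1.1
  (arXiv:0910.2026 pp. 5–6).
* [Cygan1981] J. Cygan, *Subadditivity of homogeneous norms on certain nilpotent Lie groups*,
  Proc. Amer. Math. Soc. 83 (1981) 69–70.
-/

noncomputable section

open ComplexConjugate _root_.MeasureTheory _root_.MeasureTheory.Measure Filter
open scoped _root_.Topology

namespace Literature.Geometry.MetricEmbeddings

/-- The (three-dimensional, continuous) **Heisenberg group `ℍ = ℍ(ℝ)` equipped with the
Cygan–Korányi metric**: a type synonym of `Literature.NumberTheory.Sieve.Heis` (the Heisenberg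
group `H³(ℝ)` in polarized coordinates `(x, y, z) ↔ [[1,x,z],[0,1,y],[0,0,1]]`, law
`(x,y,z)·(x',y',z') = (x+x', y+y', z+z'+xy')`, which carries the EUCLIDEAN metric of `ℝ³`); the
synonym carries the same group structure and the left-invariant homogeneous metric
`d_K(p,q) = ‖p⁻¹q‖_K` instead (as `WithLp` re-metrises a product).
[cite: CheegerKleinerNaor2011, §1.1] -/
def HeisK : Type := _root_.Literature.NumberTheory.Sieve.Heis

namespace HeisK

/-- The element with coordinates `(a, b, c)`. [cite: CheegerKleinerNaor2011, §1.1] -/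
def mk (a b c : ℝ) : HeisK := _root_.Literature.NumberTheory.Sieve.Heis.mk a b c

/-- First horizontal coordinate. [cite: CheegerKleinerNaor2011, §1.1] -/
def x (p : HeisK) : ℝ := _root_.Literature.NumberTheory.Sieve.Heis.x p
/-- Second horizontal coordinate. [cite: CheegerKleinerNaor2011, §1.1] -/
def y (p : HeisK) : ℝ := _root_.Literature.NumberTheory.Sieve.Heis.y p
/-- Vertical (central) coordinate. [cite: CheegerKleinerNaor2011, §1.1] -/
def z (p : HeisK) : ℝ := _root_.Literature.NumberTheory.Sieve.Heis.z p

/-- [cite: CheegerKleinerNaor2011, §1.1] -/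
@[simp] theorem mk_x (a b c : ℝ) : (mk a b c).x = a := rfl
/-- [cite: CheegerKleinerNaor2011, §1.1] -/
@[simp] theorem mk_y (a b c : ℝ) : (mk a b c).y = b := rfl
/-- [cite: CheegerKleinerNaor2011, §1.1] -/
@[simp] theorem mk_z (a b c : ℝ) : (mk a b c).z = c := rfl

/-- Extensionality in coordinates. [cite: CheegerKleinerNaor2011, §1.1] -/
@[ext] theorem ext {p q : HeisK} (hx : p.x = q.x) (hy : p.y = q.y) (hz : p.z = q.z) : p = q :=
  _root_.Literature.NumberTheory.Sieve.Heis.ext hx hy hz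

/-- An element is `mk` of its coordinates. [cite: CheegerKleinerNaor2011, §1.1] -/
theorem mk_xyz (p : HeisK) : mk p.x p.y p.z = p := rfl

/-- The group structure of `ℍ`, transported verbatim from `Literature.NumberTheory.Sieve.Heis`
(law `(x,y,z)·(x',y',z') = (x+x', y+y', z+z'+xy')`, identity `(0,0,0)`, inverse
`(−x, −y, −z + xy)`; nilpotent of step two, the centre is the `z`-axis).
[cite: CheegerKleinerNaor2011, §1.1] -/
instance : Group HeisK := inferInstanceAs (Group _root_.Literature.NumberTheory.Sieve.Heis)

/-- The identity map to the Euclidean-metric copy `Literature.NumberTheory.Sieve.Heis` is a group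
isomorphism (the two types differ only in their metric). [cite: CheegerKleinerNaor2011, §1.1] -/
def toHeis : HeisK ≃* _root_.Literature.NumberTheory.Sieve.Heis := MulEquiv.refl _

/-- [cite: CheegerKleinerNaor2011, §1.1] -/
@[simp] theorem toHeis_mk (a b c : ℝ) :
    toHeis (mk a b c) = _root_.Literature.NumberTheory.Sieve.Heis.mk a b c := rfl

/-- [cite: CheegerKleinerNaor2011, §1.1] -/
@[simp] theorem mul_x (p q : HeisK) : (p * q).x = p.x + q.x := rfl
/-- [cite: CheegerKleinerNaor2011, §1.1] -/
@[simp] theorem mul_y (p q : HeisK) : (p * q).y = p.y + q.y := rfl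
/-- [cite: CheegerKleinerNaor2011, §1.1] -/
@[simp] theorem mul_z (p q : HeisK) : (p * q).z = p.z + q.z + p.x * q.y := rfl
/-- [cite: CheegerKleinerNaor2011, §1.1] -/
@[simp] theorem one_x : (1 : HeisK).x = 0 := rfl
/-- [cite: CheegerKleinerNaor2011, §1.1] -/
@[simp] theorem one_y : (1 : HeisK).y = 0 := rfl
/-- [cite: CheegerKleinerNaor2011, §1.1] -/
@[simp] theorem one_z : (1 : HeisK).z = 0 := rfl
/-- [cite: CheegerKleinerNaor2011, §1.1] -/
@[simp] theorem inv_x (p : HeisK) : p⁻¹.x = -p.x := rfl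
/-- [cite: CheegerKleinerNaor2011, §1.1] -/
@[simp] theorem inv_y (p : HeisK) : p⁻¹.y = -p.y := rfl
/-- [cite: CheegerKleinerNaor2011, §1.1] -/
@[simp] theorem inv_z (p : HeisK) : p⁻¹.z = -p.z + p.x * p.y := rfl

/-- The commutator of two elements is central: `p q p⁻¹ q⁻¹ = (0, 0, x y' − x' y)`.
[cite: CheegerKleinerNaor2011, §1.1] -/
theorem commutator_eq (p q : HeisK) : p * q * p⁻¹ * q⁻¹ = mk 0 0 (p.x * q.y - q.x * p.y) := by
  ext <;> simp only [mul_x, mul_y, mul_z, inv_x, inv_y, inv_z, mk_x, mk_y, mk_z] <;> ring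

/-- Elements of the `z`-axis are central. [cite: CheegerKleinerNaor2011, §1.1] -/
theorem center_mul_comm (c : ℝ) (p : HeisK) : mk 0 0 c * p = p * mk 0 0 c := by
  ext <;> simp only [mul_x, mul_y, mul_z, mk_x, mk_y, mk_z] <;> ring

/-! ### Dilations -/

/-- The **dilation** (homothety) `δ_s(x,y,z) = (s x, s y, s² z)` ("`A_R(a,b,c) = (Ra,Rb,R²c)`").
[cite: CheegerKleinerNaor2011, §1.1] -/
def dilate (s : ℝ) (p : HeisK) : HeisK := mk (s * p.x) (s * p.y) (s ^ 2 * p.z)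

/-- [cite: CheegerKleinerNaor2011, §1.1] -/
@[simp] theorem dilate_x (s : ℝ) (p : HeisK) : (dilate s p).x = s * p.x := rfl
/-- [cite: CheegerKleinerNaor2011, §1.1] -/
@[simp] theorem dilate_y (s : ℝ) (p : HeisK) : (dilate s p).y = s * p.y := rfl
/-- [cite: CheegerKleinerNaor2011, §1.1] -/
@[simp] theorem dilate_z (s : ℝ) (p : HeisK) : (dilate s p).z = s ^ 2 * p.z := rfl

/-- Dilations are group endomorphisms ("`A_R` is an automorphism of `ℍ`").
[cite: CheegerKleinerNaor2011, §1.1] -/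
theorem dilate_mul (s : ℝ) (p q : HeisK) : dilate s (p * q) = dilate s p * dilate s q := by
  ext <;> simp only [dilate_x, dilate_y, dilate_z, mul_x, mul_y, mul_z] <;> ring

/-- [cite: CheegerKleinerNaor2011, §1.1] -/
@[simp] theorem dilate_one (s : ℝ) : dilate s 1 = 1 := by
  ext <;> simp

/-- [cite: CheegerKleinerNaor2011, §1.1] -/
theorem dilate_inv (s : ℝ) (p : HeisK) : dilate s p⁻¹ = (dilate s p)⁻¹ := by
  ext <;> simp only [dilate_x, dilate_y, dilate_z, inv_x, inv_y, inv_z] <;> ring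

/-- `δ_s ∘ δ_t = δ_{st}`. [cite: CheegerKleinerNaor2011, §1.1] -/
theorem dilate_dilate (s t : ℝ) (p : HeisK) : dilate s (dilate t p) = dilate (s * t) p := by
  ext <;> simp only [dilate_x, dilate_y, dilate_z] <;> ring

/-- `δ_1 = id`. [cite: CheegerKleinerNaor2011, §1.1] -/
@[simp] theorem dilate_one_left (p : HeisK) : dilate 1 p = p := by
  ext <;> simp

/-! ### The Cygan–Korányi gauge and metric -/

/-- The quartic form `Q(x,y,z) = (x²+y²)² + 4(2z − xy)²` (`= |w|⁴ + t²` for `w = x+iy`,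
`t = −2(2z−xy)`). [cite: Cygan1981, p. 69] -/
def quartic (p : HeisK) : ℝ := (p.x ^ 2 + p.y ^ 2) ^ 2 + 4 * (2 * p.z - p.x * p.y) ^ 2

/-- The **Cygan–Korányi gauge** `‖p‖_K = Q(p)^{1/4} = √(√Q(p))`. [cite: Cygan1981, p. 69] -/
def gauge (p : HeisK) : ℝ := Real.sqrt (Real.sqrt (quartic p))

/-- [cite: Cygan1981, p. 69] -/
theorem quartic_nonneg (p : HeisK) : 0 ≤ quartic p := by
  unfold quartic; positivity

/-- [cite: Cygan1981, p. 69] -/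
theorem gauge_nonneg (p : HeisK) : 0 ≤ gauge p := Real.sqrt_nonneg _

/-- `‖p‖_K⁴ = Q(p)`. [cite: Cygan1981, p. 69] -/
theorem gauge_pow_four (p : HeisK) : gauge p ^ 4 = quartic p := by
  unfold gauge
  rw [show (4 : ℕ) = 2 * 2 by norm_num, pow_mul, Real.sq_sqrt (Real.sqrt_nonneg _),
    Real.sq_sqrt (quartic_nonneg p)]

/-- `‖p‖_K = Q(p)^{1/4}` as a real power. [cite: Cygan1981, p. 69] -/
theorem gauge_eq_rpow (p : HeisK) : gauge p = quartic p ^ (1 / 4 : ℝ) := by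
  unfold gauge
  rw [Real.sqrt_eq_rpow, Real.sqrt_eq_rpow, ← Real.rpow_mul (quartic_nonneg p)]
  norm_num

/-- [cite: Cygan1981, p. 69] -/
@[simp] theorem quartic_one : quartic 1 = 0 := by
  simp [quartic]

/-- [cite: Cygan1981, p. 69] -/
@[simp] theorem gauge_one : gauge 1 = 0 := by
  simp [gauge]

/-- `Q(p) = 0 ↔ p = 1`. [cite: Cygan1981, p. 69] -/
theorem quartic_eq_zero_iff (p : HeisK) : quartic p = 0 ↔ p = 1 := by
  refine ⟨fun h => ?_, fun h => by rw [h, quartic_one]⟩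
  unfold quartic at h
  have h1 : (p.x ^ 2 + p.y ^ 2) ^ 2 = 0 := by nlinarith [sq_nonneg (p.x ^ 2 + p.y ^ 2), sq_nonneg (2 * p.z - p.x * p.y)]
  have h2 : (2 * p.z - p.x * p.y) ^ 2 = 0 := by nlinarith [sq_nonneg (p.x ^ 2 + p.y ^ 2), sq_nonneg (2 * p.z - p.x * p.y)]
  have h3 : p.x ^ 2 + p.y ^ 2 = 0 := pow_eq_zero_iff (n := 2) (by norm_num) |>.mp h1
  have hx : p.x = 0 := by nlinarith [sq_nonneg p.x, sq_nonneg p.y]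
  have hy : p.y = 0 := by nlinarith [sq_nonneg p.x, sq_nonneg p.y]
  have hz : p.z = 0 := by
    have := pow_eq_zero_iff (n := 2) (by norm_num) |>.mp h2
    rw [hx, hy] at this
    linarith
  ext <;> simp [hx, hy, hz]

/-- `‖p‖_K = 0 ↔ p = 1`. [cite: Cygan1981, p. 69] -/
theorem gauge_eq_zero_iff (p : HeisK) : gauge p = 0 ↔ p = 1 := by
  rw [← quartic_eq_zero_iff, gauge, Real.sqrt_eq_zero (Real.sqrt_nonneg _),
    Real.sqrt_eq_zero (quartic_nonneg p)]

/-- `Q(p⁻¹) = Q(p)`. [cite: Cygan1981, p. 69] -/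
theorem quartic_inv (p : HeisK) : quartic p⁻¹ = quartic p := by
  simp only [quartic, inv_x, inv_y, inv_z]
  ring

/-- The gauge is symmetric: `‖p⁻¹‖_K = ‖p‖_K`. [cite: Cygan1981, p. 69] -/
theorem gauge_inv (p : HeisK) : gauge p⁻¹ = gauge p := by
  rw [gauge, gauge, quartic_inv]

/-- `Q(δ_s p) = s⁴ Q(p)`. [cite: Cygan1981, p. 69] -/
theorem quartic_dilate (s : ℝ) (p : HeisK) : quartic (dilate s p) = s ^ 4 * quartic p := by
  simp only [quartic, dilate_x, dilate_y, dilate_z]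
  ring

/-- The gauge is homogeneous: `‖δ_s p‖_K = |s| ‖p‖_K`. [cite: Cygan1981, p. 69] -/
theorem gauge_dilate (s : ℝ) (p : HeisK) : gauge (dilate s p) = |s| * gauge p := by
  rw [gauge, gauge, quartic_dilate, show s ^ 4 = (s ^ 2) ^ 2 by ring,
    Real.sqrt_mul' _ (quartic_nonneg p), Real.sqrt_sq (sq_nonneg s),
    Real.sqrt_mul' _ (Real.sqrt_nonneg _), Real.sqrt_sq_eq_abs]

/-- Cygan's complex coordinate `A(p) = |w|² + i t = (x²+y²) − 2(2z−xy) i`, with `|A(p)| = √Q(p)`.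
[cite: Cygan1981, p. 69] -/
def cyganA (p : HeisK) : ℂ := ⟨p.x ^ 2 + p.y ^ 2, -2 * (2 * p.z - p.x * p.y)⟩

/-- The horizontal part `w(p) = x + iy`. [cite: Cygan1981, p. 69] -/
def horiz (p : HeisK) : ℂ := ⟨p.x, p.y⟩

/-- `|A(p)| = √Q(p) = ‖p‖_K²`. [cite: Cygan1981, p. 69] -/
theorem norm_cyganA (p : HeisK) : ‖cyganA p‖ = Real.sqrt (quartic p) := by
  rw [Complex.norm_def, Complex.normSq_apply]
  congr 1
  simp only [cyganA, quartic]
  ring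

/-- `‖p‖_K = √|A(p)|`. [cite: Cygan1981, p. 69] -/
theorem gauge_eq_sqrt_norm (p : HeisK) : gauge p = Real.sqrt ‖cyganA p‖ := by
  rw [gauge, norm_cyganA]

/-- `|w(p)|² = Re A(p) ≤ |A(p)|`, hence `|w(p)| ≤ ‖p‖_K`. [cite: Cygan1981, p. 69] -/
theorem norm_horiz_le_gauge (p : HeisK) : ‖horiz p‖ ≤ gauge p := by
  have h : ‖horiz p‖ ^ 2 ≤ ‖cyganA p‖ :=
    calc ‖horiz p‖ ^ 2 = (cyganA p).re := by
          rw [Complex.sq_norm, Complex.normSq_apply]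
          simp only [horiz, cyganA]
          ring
      _ ≤ ‖cyganA p‖ := Complex.re_le_norm _
  rw [gauge_eq_sqrt_norm, ← Real.sqrt_sq (norm_nonneg (horiz p))]
  exact Real.sqrt_le_sqrt h

/-- **Cygan's identity**: `A(pq) = A(p) + A(q) + 2 w(p) \overline{w(q)}`. [cite: Cygan1981, p. 70] -/
theorem cyganA_mul (p q : HeisK) :
    cyganA (p * q) = cyganA p + cyganA q + 2 * (horiz p * conj (horiz q)) := by
  apply Complex.ext
  · simp [cyganA, horiz, Complex.mul_re, Complex.mul_im]
    ring
  · simp [cyganA, horiz, Complex.mul_re, Complex.mul_im]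
    ring

/-- **Cygan's subadditivity theorem** for the Korányi gauge on `ℍ`:
`‖p q‖_K ≤ ‖p‖_K + ‖q‖_K`. Proof: `‖pq‖_K² = |A(pq)| ≤ |A(p)| + |A(q)| + 2|w(p)||w(q)|
≤ ‖p‖_K² + ‖q‖_K² + 2‖p‖_K‖q‖_K`. [cite: Cygan1981, Theorem (p. 69)] -/
theorem gauge_mul_le (p q : HeisK) : gauge (p * q) ≤ gauge p + gauge q := by
  have hp := gauge_nonneg p
  have hq := gauge_nonneg q
  have h1 : ‖cyganA (p * q)‖ ≤ ‖cyganA p‖ + ‖cyganA q‖ + 2 * (‖horiz p‖ * ‖horiz q‖) := by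
    rw [cyganA_mul]
    calc ‖cyganA p + cyganA q + 2 * (horiz p * conj (horiz q))‖
        ≤ ‖cyganA p + cyganA q‖ + ‖2 * (horiz p * conj (horiz q))‖ := norm_add_le _ _
      _ ≤ (‖cyganA p‖ + ‖cyganA q‖) + ‖2 * (horiz p * conj (horiz q))‖ :=
          add_le_add (norm_add_le _ _) le_rfl
      _ = ‖cyganA p‖ + ‖cyganA q‖ + 2 * (‖horiz p‖ * ‖horiz q‖) := by
          rw [norm_mul, norm_mul, Complex.norm_conj]
          norm_num
  have h2 : ‖horiz p‖ * ‖horiz q‖ ≤ gauge p * gauge q :=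
    mul_le_mul (norm_horiz_le_gauge p) (norm_horiz_le_gauge q) (norm_nonneg _) hp
  have hsqp : ‖cyganA p‖ = gauge p ^ 2 := by
    rw [gauge_eq_sqrt_norm, Real.sq_sqrt (norm_nonneg _)]
  have hsqq : ‖cyganA q‖ = gauge q ^ 2 := by
    rw [gauge_eq_sqrt_norm, Real.sq_sqrt (norm_nonneg _)]
  have h3 : ‖cyganA (p * q)‖ ≤ (gauge p + gauge q) ^ 2 := by
    calc ‖cyganA (p * q)‖ ≤ ‖cyganA p‖ + ‖cyganA q‖ + 2 * (‖horiz p‖ * ‖horiz q‖) := h1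
      _ ≤ gauge p ^ 2 + gauge q ^ 2 + 2 * (gauge p * gauge q) := by rw [hsqp, hsqq]; gcongr
      _ = (gauge p + gauge q) ^ 2 := by ring
  calc gauge (p * q) = Real.sqrt ‖cyganA (p * q)‖ := gauge_eq_sqrt_norm _
    _ ≤ Real.sqrt ((gauge p + gauge q) ^ 2) := Real.sqrt_le_sqrt h3
    _ = gauge p + gauge q := Real.sqrt_sq (by positivity)

/-- Each horizontal coordinate is bounded by the gauge: `|x| ≤ ‖p‖_K`. [cite: Cygan1981, p. 69] -/
theorem abs_x_le_gauge (p : HeisK) : |p.x| ≤ gauge p := by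
  refine le_trans ?_ (norm_horiz_le_gauge p)
  simpa [horiz] using Complex.abs_re_le_norm (horiz p)

/-- `|y| ≤ ‖p‖_K`. [cite: Cygan1981, p. 69] -/
theorem abs_y_le_gauge (p : HeisK) : |p.y| ≤ gauge p := by
  refine le_trans ?_ (norm_horiz_le_gauge p)
  simpa [horiz] using Complex.abs_im_le_norm (horiz p)

/-- The vertical coordinate is bounded by the square of the gauge: `2|2z − xy| ≤ ‖p‖_K²`.
[cite: Cygan1981, p. 69] -/
theorem abs_vert_le_gauge_sq (p : HeisK) : 2 * |2 * p.z - p.x * p.y| ≤ gauge p ^ 2 := by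
  have h : (2 * |2 * p.z - p.x * p.y|) ^ 2 ≤ (gauge p ^ 2) ^ 2 := by
    rw [← pow_mul, show 2 * 2 = 4 by norm_num, gauge_pow_four, mul_pow, sq_abs, quartic]
    nlinarith [sq_nonneg (p.x ^ 2 + p.y ^ 2)]
  have h' := sq_le_sq.mp h
  rwa [abs_of_nonneg (by positivity : (0 : ℝ) ≤ 2 * |2 * p.z - p.x * p.y|),
    abs_of_nonneg (by positivity : (0 : ℝ) ≤ gauge p ^ 2)] at h'

/-- Fourth-root monotonicity: `Q(p) ≤ r⁴` with `r ≥ 0` gives `‖p‖_K ≤ r`. [cite: Cygan1981, p. 69] -/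
theorem gauge_le_of_quartic_le {p : HeisK} {r : ℝ} (hr : 0 ≤ r) (h : quartic p ≤ r ^ 4) :
    gauge p ≤ r := by
  have h4 : (gauge p ^ 2) ^ 2 ≤ (r ^ 2) ^ 2 := by
    rw [← pow_mul, ← pow_mul, show 2 * 2 = 4 by norm_num, gauge_pow_four]
    exact h
  have h2 := sq_le_sq.mp h4
  rw [abs_of_nonneg (sq_nonneg _), abs_of_nonneg (sq_nonneg _)] at h2
  have h1 := sq_le_sq.mp h2
  rwa [abs_of_nonneg (gauge_nonneg _), abs_of_nonneg hr] at h1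

/-- Conversely `r⁴ ≤ Q(p)` with `r ≥ 0` gives `r ≤ ‖p‖_K`. [cite: Cygan1981, p. 69] -/
theorem le_gauge_of_le_quartic {p : HeisK} {r : ℝ} (hr : 0 ≤ r) (h : r ^ 4 ≤ quartic p) :
    r ≤ gauge p := by
  have h4 : (r ^ 2) ^ 2 ≤ (gauge p ^ 2) ^ 2 := by
    rw [← pow_mul, ← pow_mul, show 2 * 2 = 4 by norm_num, gauge_pow_four]
    exact h
  have h2 := sq_le_sq.mp h4
  rw [abs_of_nonneg (sq_nonneg _), abs_of_nonneg (sq_nonneg _)] at h2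
  have h1 := sq_le_sq.mp h2
  rwa [abs_of_nonneg (gauge_nonneg _), abs_of_nonneg hr] at h1

/-! ### The Cygan–Korányi metric space structure -/

/-- `ℍ` as a metric space with the left-invariant **Cygan–Korányi metric**
`d_K(p,q) = ‖p⁻¹q‖_K` (triangle inequality = Cygan's subadditivity `gauge_mul_le`).
[cite: Cygan1981, Theorem (p. 69)] -/
instance : MetricSpace HeisK where
  dist p q := gauge (p⁻¹ * q)
  dist_self p := by simp
  dist_comm p q := by
    rw [← gauge_inv (p⁻¹ * q), mul_inv_rev, inv_inv]
  dist_triangle p q r := by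
    calc gauge (p⁻¹ * r) = gauge ((p⁻¹ * q) * (q⁻¹ * r)) := by
          rw [mul_assoc, mul_inv_cancel_left]
      _ ≤ gauge (p⁻¹ * q) + gauge (q⁻¹ * r) := gauge_mul_le _ _
  eq_of_dist_eq_zero {p q} h := inv_mul_eq_one.mp ((gauge_eq_zero_iff _).mp h)

/-- `d_K(p,q) = ‖p⁻¹q‖_K`. [cite: Cygan1981, p. 69] -/
theorem dist_eq (p q : HeisK) : dist p q = gauge (p⁻¹ * q) := rfl

/-- `d_K(1,p) = ‖p‖_K`. [cite: Cygan1981, p. 69] -/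
theorem dist_one_left (p : HeisK) : dist 1 p = gauge p := by
  rw [dist_eq, inv_one, one_mul]

/-- **Left-invariance**: `d_K(kp, kq) = d_K(p,q)`. [cite: CheegerKleinerNaor2011, §1.1] -/
theorem dist_mul_left (k p q : HeisK) : dist (k * p) (k * q) = dist p q := by
  rw [dist_eq, dist_eq, mul_inv_rev, mul_assoc, inv_mul_cancel_left]

/-- **Dilations are homotheties**: `d_K(δ_s p, δ_s q) = |s| d_K(p,q)` ("`A_R` … is also a
homothety of the metric"). [cite: CheegerKleinerNaor2011, §1.1] -/
theorem dist_dilate (s : ℝ) (p q : HeisK) : dist (dilate s p) (dilate s q) = |s| * dist p q := by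
  rw [dist_eq, dist_eq, ← dilate_inv, ← dilate_mul, gauge_dilate]

/-! ### Topology: the Cygan–Korányi metric induces the Euclidean topology -/

/-- Coordinates: `ℍ ≃ ℝ³` as plain sets. [cite: CheegerKleinerNaor2011, §1.1] -/
def equivProd : HeisK ≃ ℝ × ℝ × ℝ where
  toFun p := (p.x, p.y, p.z)
  invFun t := mk t.1 t.2.1 t.2.2
  left_inv _ := rfl
  right_inv _ := rfl

/-- [cite: CheegerKleinerNaor2011, §1.1] -/
@[simp] theorem equivProd_apply (p : HeisK) : equivProd p = (p.x, p.y, p.z) := rfl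
/-- [cite: CheegerKleinerNaor2011, §1.1] -/
@[simp] theorem equivProd_symm_apply (t : ℝ × ℝ × ℝ) : equivProd.symm t = mk t.1 t.2.1 t.2.2 := rfl

/-- The coordinate `x` is `1`-Lipschitz for `d_K`. [cite: Cygan1981, p. 69] -/
theorem lipschitzWith_x : LipschitzWith 1 HeisK.x :=
  LipschitzWith.mk_one fun p q => by
    rw [Real.dist_eq, abs_sub_comm, dist_eq]
    have h := abs_x_le_gauge (p⁻¹ * q)
    rwa [mul_x, inv_x, neg_add_eq_sub] at h

/-- The coordinate `y` is `1`-Lipschitz for `d_K`. [cite: Cygan1981, p. 69] -/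
theorem lipschitzWith_y : LipschitzWith 1 HeisK.y :=
  LipschitzWith.mk_one fun p q => by
    rw [Real.dist_eq, abs_sub_comm, dist_eq]
    have h := abs_y_le_gauge (p⁻¹ * q)
    rwa [mul_y, inv_y, neg_add_eq_sub] at h

/-- Local control of the vertical coordinate: `|z(q) − z(p)| ≤ d_K(p,q)² + |x(p)| d_K(p,q)`.
[cite: Cygan1981, p. 69] -/
theorem abs_z_sub_z_le (p q : HeisK) : |q.z - p.z| ≤ dist p q ^ 2 + |p.x| * dist p q := by
  rw [dist_eq]
  set r := p⁻¹ * q with hr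
  have hz : q.z - p.z = r.z + p.x * r.y := by
    simp only [hr, mul_z, mul_y, inv_z, inv_x, inv_y]
    ring
  have h1 := abs_vert_le_gauge_sq r
  have h2 := abs_x_le_gauge r
  have h3 := abs_y_le_gauge r
  have h4 := abs_sub_abs_le_abs_sub (2 * r.z) (r.x * r.y)
  rw [abs_mul, abs_two] at h4
  have hxy : |r.x * r.y| ≤ gauge r ^ 2 := by
    rw [abs_mul, sq]
    exact mul_le_mul h2 h3 (abs_nonneg _) (gauge_nonneg _)
  have h5 : |r.z| ≤ gauge r ^ 2 := by linarith [sq_nonneg (gauge r)]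
  calc |q.z - p.z| = |r.z + p.x * r.y| := by rw [hz]
    _ ≤ |r.z| + |p.x * r.y| := abs_add_le _ _
    _ = |r.z| + |p.x| * |r.y| := by rw [abs_mul]
    _ ≤ gauge r ^ 2 + |p.x| * gauge r := add_le_add h5 (mul_le_mul_of_nonneg_left h3 (abs_nonneg _))

/-- The coordinate `z` is continuous for `d_K`. [cite: Cygan1981, p. 69] -/
theorem continuous_z : Continuous HeisK.z := by
  refine continuous_iff_continuousAt.2 fun p => ?_
  rw [Metric.continuousAt_iff]
  intro ε hε
  have hε' : 0 < ε / (2 * (1 + |p.x|)) := by positivity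
  refine ⟨min 1 (ε / (2 * (1 + |p.x|))), lt_min one_pos hε', fun {q} hq => ?_⟩
  rw [Real.dist_eq]
  rw [dist_comm] at hq
  have hd1 : dist p q < 1 := lt_of_lt_of_le hq (min_le_left _ _)
  have hd2 : dist p q < ε / (2 * (1 + |p.x|)) := lt_of_lt_of_le hq (min_le_right _ _)
  have hd0 : 0 ≤ dist p q := dist_nonneg
  have h := abs_z_sub_z_le p q
  have hsq : dist p q ^ 2 ≤ dist p q := by nlinarith
  have hkey : |q.z - p.z| ≤ (1 + |p.x|) * dist p q := by nlinarith [abs_nonneg p.x]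
  have hfin : (1 + |p.x|) * dist p q < ε := by
    calc (1 + |p.x|) * dist p q < (1 + |p.x|) * (ε / (2 * (1 + |p.x|))) :=
          mul_lt_mul_of_pos_left hd2 (by positivity)
      _ = ε / 2 := by field_simp
      _ < ε := by linarith
  linarith

/-- The coordinate map `ℍ → ℝ³` is continuous for `d_K`. [cite: Cygan1981, p. 69] -/
theorem continuous_equivProd : Continuous equivProd :=
  lipschitzWith_x.continuous.prodMk (lipschitzWith_y.continuous.prodMk continuous_z)

/-- The inverse coordinate map `ℝ³ → ℍ` is continuous for `d_K` (the gauge is a continuous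
function of the coordinates). [cite: Cygan1981, p. 69] -/
theorem continuous_equivProd_symm : Continuous equivProd.symm := by
  refine continuous_iff_continuousAt.2 fun t₀ => ?_
  rw [ContinuousAt, tendsto_iff_dist_tendsto_zero]
  have hpoly : Continuous fun t : ℝ × ℝ × ℝ =>
      quartic ((equivProd.symm t)⁻¹ * equivProd.symm t₀) := by
    have e : (fun t : ℝ × ℝ × ℝ => quartic ((equivProd.symm t)⁻¹ * equivProd.symm t₀)) =
        fun t => ((-t.1 + t₀.1) ^ 2 + (-t.2.1 + t₀.2.1) ^ 2) ^ 2 +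
          4 * (2 * (-t.2.2 + t.1 * t.2.1 + t₀.2.2 + -t.1 * t₀.2.1) -
            (-t.1 + t₀.1) * (-t.2.1 + t₀.2.1)) ^ 2 := by
      funext t
      simp only [quartic, mul_x, mul_y, mul_z, inv_x, inv_y, inv_z, equivProd_symm_apply, mk_x, mk_y,
        mk_z]
    rw [e]
    fun_prop
  have hc : Continuous fun t : ℝ × ℝ × ℝ => dist (equivProd.symm t) (equivProd.symm t₀) := by
    simp only [dist_eq, gauge]
    exact Real.continuous_sqrt.comp (Real.continuous_sqrt.comp hpoly)
  have := hc.tendsto t₀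
  rwa [dist_self] at this

/-- **`ℍ` is homeomorphic to `ℝ³`** via coordinates: the Cygan–Korányi metric induces the
Euclidean topology. [cite: CheegerKleinerNaor2011, §1.1] -/
def homeomorphProd : HeisK ≃ₜ ℝ × ℝ × ℝ where
  toEquiv := equivProd
  continuous_toFun := continuous_equivProd
  continuous_invFun := continuous_equivProd_symm

/-- [cite: CheegerKleinerNaor2011, §1.1] -/
@[simp] theorem homeomorphProd_apply (p : HeisK) : homeomorphProd p = (p.x, p.y, p.z) := rfl
/-- [cite: CheegerKleinerNaor2011, §1.1] -/
@[simp] theorem homeomorphProd_symm_apply (t : ℝ × ℝ × ℝ) :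
    homeomorphProd.symm t = mk t.1 t.2.1 t.2.2 := rfl

/-- Multiplication is continuous (polynomial in coordinates). [cite: CheegerKleinerNaor2011, §1.1] -/
theorem continuous_mul' : Continuous fun pq : HeisK × HeisK => pq.1 * pq.2 := by
  have e : (fun pq : HeisK × HeisK => pq.1 * pq.2) =
      equivProd.symm ∘ (fun tu : (ℝ × ℝ × ℝ) × (ℝ × ℝ × ℝ) =>
        (tu.1.1 + tu.2.1, tu.1.2.1 + tu.2.2.1, tu.1.2.2 + tu.2.2.2 + tu.1.1 * tu.2.2.1)) ∘
        (fun pq : HeisK × HeisK => (equivProd pq.1, equivProd pq.2)) := by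
    funext pq
    rfl
  rw [e]
  have hmid : Continuous fun tu : (ℝ × ℝ × ℝ) × (ℝ × ℝ × ℝ) =>
      (tu.1.1 + tu.2.1, tu.1.2.1 + tu.2.2.1, tu.1.2.2 + tu.2.2.2 + tu.1.1 * tu.2.2.1) := by
    fun_prop
  exact continuous_equivProd_symm.comp
    (hmid.comp (continuous_equivProd.fst'.prodMk continuous_equivProd.snd'))

/-- Inversion is continuous (polynomial in coordinates). [cite: CheegerKleinerNaor2011, §1.1] -/
theorem continuous_inv' : Continuous fun p : HeisK => p⁻¹ := by
  have e : (fun p : HeisK => p⁻¹) =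
      equivProd.symm ∘ (fun t : ℝ × ℝ × ℝ => (-t.1, -t.2.1, -t.2.2 + t.1 * t.2.1)) ∘ equivProd := by
    funext p
    rfl
  rw [e]
  have hmid : Continuous fun t : ℝ × ℝ × ℝ => (-t.1, -t.2.1, -t.2.2 + t.1 * t.2.1) := by
    fun_prop
  exact continuous_equivProd_symm.comp (hmid.comp continuous_equivProd)

/-- `ℍ` is a topological group. [cite: CheegerKleinerNaor2011, §1.1] -/
instance : IsTopologicalGroup HeisK where
  continuous_mul := continuous_mul'
  continuous_inv := continuous_inv'

/-! ### Haar measure = Lebesgue measure in coordinates -/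

/-- The Borel σ-algebra of `ℍ`. [cite: CheegerKleinerNaor2011, §1.1] -/
instance : MeasurableSpace HeisK := borel HeisK

/-- [cite: CheegerKleinerNaor2011, §1.1] -/
instance : BorelSpace HeisK := ⟨rfl⟩

/-- Coordinates as a measurable equivalence. [cite: CheegerKleinerNaor2011, §1.1] -/
def measurableEquivProd : HeisK ≃ᵐ ℝ × ℝ × ℝ := homeomorphProd.toMeasurableEquiv

/-- [cite: CheegerKleinerNaor2011, §1.1] -/
@[simp] theorem measurableEquivProd_apply (p : HeisK) : measurableEquivProd p = (p.x, p.y, p.z) := rfl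
/-- [cite: CheegerKleinerNaor2011, §1.1] -/
@[simp] theorem measurableEquivProd_symm_apply (t : ℝ × ℝ × ℝ) :
    measurableEquivProd.symm t = mk t.1 t.2.1 t.2.2 := rfl

/-- **Haar measure on `ℍ`**: Lebesgue measure `dx dy dz` transported along the coordinates
("with respect to Haar measure", [CKN Thm. 1.1]). [cite: CheegerKleinerNaor2011, §1.1] -/
instance : MeasureSpace HeisK := ⟨Measure.map measurableEquivProd.symm volume⟩

/-- [cite: CheegerKleinerNaor2011, §1.1] -/
theorem volume_eq : (volume : Measure HeisK) = Measure.map measurableEquivProd.symm volume := rfl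

/-- The coordinates identify Haar measure on `ℍ` with Lebesgue measure on `ℝ³`.
[cite: CheegerKleinerNaor2011, §1.1] -/
theorem measurePreserving_equivProd_symm :
    MeasurePreserving measurableEquivProd.symm (volume : Measure (ℝ × ℝ × ℝ)) volume :=
  ⟨measurableEquivProd.symm.measurable, rfl⟩

/-- [cite: CheegerKleinerNaor2011, §1.1] -/
theorem measurePreserving_equivProd :
    MeasurePreserving measurableEquivProd (volume : Measure HeisK) volume := by
  simpa using measurePreserving_equivProd_symm.symm

/-- In coordinates, left translation by `k` is the measure-preserving affine map
`t ↦ (k₁ + t₁, k₂ + t₂, k₃ + (t₃ + k₁ t₂))` (a shear followed by a translation).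
[cite: CheegerKleinerNaor2011, §1.1] -/
theorem measurePreserving_coord_mul_left (k : HeisK) :
    MeasurePreserving
      (fun t : ℝ × ℝ × ℝ => (k.x + t.1, k.y + t.2.1, k.z + (t.2.2 + k.x * t.2.1)))
      (volume : Measure (ℝ × ℝ × ℝ)) volume := by
  -- the shear `(a, b) ↦ (a, b + k₁ a)` of the `(y, z)`-plane
  have h2 : MeasurePreserving (fun u : ℝ × ℝ => (u.1, u.2 + k.x * u.1))
      (volume : Measure (ℝ × ℝ)) volume := by
    have := (MeasurePreserving.id (volume : Measure ℝ)).skew_product (g := fun a b => b + k.x * a)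
      (by fun_prop) (Filter.Eventually.of_forall fun a => map_add_right_eq_self volume (k.x * a))
    rw [Measure.volume_eq_prod]
    simpa using this
  have hS : MeasurePreserving (fun t : ℝ × ℝ × ℝ => (t.1, t.2.1, t.2.2 + k.x * t.2.1))
      (volume : Measure (ℝ × ℝ × ℝ)) volume := by
    have := (MeasurePreserving.id (volume : Measure ℝ)).prod h2
    rw [Measure.volume_eq_prod]
    exact this
  -- the translation, as a product of one-dimensional translations
  have hT : MeasurePreserving (fun t : ℝ × ℝ × ℝ => (k.x + t.1, k.y + t.2.1, k.z + t.2.2))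
      (volume : Measure (ℝ × ℝ × ℝ)) volume := by
    have h1 := measurePreserving_add_left (volume : Measure ℝ) k.x
    have h2' := measurePreserving_add_left (volume : Measure ℝ) k.y
    have h3 := measurePreserving_add_left (volume : Measure ℝ) k.z
    have h23 : MeasurePreserving (fun u : ℝ × ℝ => (k.y + u.1, k.z + u.2))
        (volume : Measure (ℝ × ℝ)) volume := by
      rw [Measure.volume_eq_prod]
      exact h2'.prod h3
    rw [Measure.volume_eq_prod]
    exact h1.prod h23
  exact hT.comp hS

/-- **Haar measure is left-invariant**: `p ↦ k·p` preserves volume.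
[cite: CheegerKleinerNaor2011, §1.1] -/
theorem measurePreserving_mul_left (k : HeisK) :
    MeasurePreserving (fun p : HeisK => k * p) (volume : Measure HeisK) volume := by
  have hconj : (fun p : HeisK => k * p) = measurableEquivProd.symm ∘
      (fun t : ℝ × ℝ × ℝ => (k.x + t.1, k.y + t.2.1, k.z + (t.2.2 + k.x * t.2.1))) ∘
        measurableEquivProd := by
    funext p
    ext <;> simp [add_assoc]
  rw [hconj]
  exact measurePreserving_equivProd_symm.comp
    ((measurePreserving_coord_mul_left k).comp measurePreserving_equivProd)

/-- [cite: CheegerKleinerNaor2011, §1.1] -/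
instance : (volume : Measure HeisK).IsMulLeftInvariant :=
  ⟨fun k => (measurePreserving_mul_left k).map_eq⟩

/-- Haar measure on `ℍ` is finite on compact sets. [cite: CheegerKleinerNaor2011, §1.1] -/
instance : IsFiniteMeasureOnCompacts (volume : Measure HeisK) := by
  refine ⟨fun K hK => ?_⟩
  rw [volume_eq, Measure.map_apply measurableEquivProd.symm.measurable hK.measurableSet]
  have : measurableEquivProd.symm ⁻¹' K = homeomorphProd '' K := by
    ext t
    simp only [Set.mem_preimage, Set.mem_image]
    constructor
    · intro h
      exact ⟨measurableEquivProd.symm t, h, by simp [measurableEquivProd]⟩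
    · rintro ⟨p, hp, rfl⟩
      simpa [measurableEquivProd, mk_xyz] using hp
  rw [this]
  exact (hK.image homeomorphProd.continuous).measure_lt_top

/-- Haar measure on `ℍ` charges open sets. [cite: CheegerKleinerNaor2011, §1.1] -/
instance : (volume : Measure HeisK).IsOpenPosMeasure := by
  rw [volume_eq]
  exact homeomorphProd.symm.continuous.isOpenPosMeasure_map homeomorphProd.symm.surjective

/-- Lebesgue measure in coordinates is a Haar measure of `ℍ`. [cite: CheegerKleinerNaor2011, §1.1] -/
instance : (volume : Measure HeisK).IsHaarMeasure where

/-! ### The integer lattice `ℍ(ℤ)` -/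

/-- The lattice point with integer coordinates `g = (g₁, g₂, g₃)`: the inclusion `ℍ(ℤ) = ℤ³ ↪ ℍ`
(a group embedding for the law `heisMul` of `HeisenbergL1.lean`, see `ofInt_mul`).
[cite: CheegerKleinerNaor2011, §1.1] -/
def ofInt (g : ℤ × ℤ × ℤ) : HeisK := mk g.1 g.2.1 g.2.2

/-- [cite: CheegerKleinerNaor2011, §1.1] -/
@[simp] theorem ofInt_x (g : ℤ × ℤ × ℤ) : (ofInt g).x = g.1 := rfl
/-- [cite: CheegerKleinerNaor2011, §1.1] -/
@[simp] theorem ofInt_y (g : ℤ × ℤ × ℤ) : (ofInt g).y = g.2.1 := rfl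
/-- [cite: CheegerKleinerNaor2011, §1.1] -/
@[simp] theorem ofInt_z (g : ℤ × ℤ × ℤ) : (ofInt g).z = g.2.2 := rfl

/-- [cite: CheegerKleinerNaor2011, §1.1] -/
@[simp] theorem ofInt_zero : ofInt (0, 0, 0) = 1 := by
  ext <;> simp

/-- `ofInt` is injective (`ℍ(ℤ)` is the integer lattice). [cite: CheegerKleinerNaor2011, §1.1] -/
theorem ofInt_injective : Function.Injective ofInt := by
  rintro ⟨a, b, c⟩ ⟨a', b', c'⟩ h
  have hx := congrArg HeisK.x h
  have hy := congrArg HeisK.y h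
  have hz := congrArg HeisK.z h
  simp only [ofInt_x, ofInt_y, ofInt_z, Int.cast_inj] at hx hy hz
  rw [hx, hy, hz]

/-- **`ℍ(ℤ)` is a subgroup**: `ofInt` turns the integer law `(g₁+h₁, g₂+h₂, g₃+h₃+g₁h₂)`
(`heisMul` of `HeisenbergL1.lean`) into the product of `ℍ`. [cite: CheegerKleinerNaor2011, §1.1] -/
theorem ofInt_mul (g h : ℤ × ℤ × ℤ) :
    ofInt (g.1 + h.1, g.2.1 + h.2.1, g.2.2 + h.2.2 + g.1 * h.2.1) = ofInt g * ofInt h := by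
  ext <;> simp

/-- Inverses of lattice points are lattice points. [cite: CheegerKleinerNaor2011, §1.1] -/
theorem ofInt_inv (g : ℤ × ℤ × ℤ) : ofInt (-g.1, -g.2.1, -g.2.2 + g.1 * g.2.1) = (ofInt g)⁻¹ := by
  ext <;> simp

/-- The quotient of two lattice points in coordinates:
`(ofInt g)⁻¹ · ofInt h = ofInt (h₁−g₁, h₂−g₂, (h₃−g₃) − g₁(h₂−g₂))`.
[cite: CheegerKleinerNaor2011, §1.1] -/
theorem ofInt_inv_mul (g h : ℤ × ℤ × ℤ) :
    (ofInt g)⁻¹ * ofInt h =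
      ofInt (h.1 - g.1, h.2.1 - g.2.1, (h.2.2 - g.2.2) - g.1 * (h.2.1 - g.2.1)) := by
  ext <;> simp <;> ring

/-- The quartic form of a lattice point is (the cast of) an integer.
[cite: Cygan1981, p. 69] -/
theorem quartic_ofInt (g : ℤ × ℤ × ℤ) :
    quartic (ofInt g) = (((g.1 ^ 2 + g.2.1 ^ 2) ^ 2 + 4 * (2 * g.2.2 - g.1 * g.2.1) ^ 2 : ℤ) : ℝ) := by
  simp only [quartic, ofInt_x, ofInt_y, ofInt_z]
  push_cast
  ring

/-- **`ℍ(ℤ)` is discrete**: a lattice point other than the identity has gauge `≥ 1`.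
[cite: CheegerKleinerNaor2011, §1.1] -/
theorem one_le_gauge_ofInt {g : ℤ × ℤ × ℤ} (hg : g ≠ (0, 0, 0)) : 1 ≤ gauge (ofInt g) := by
  obtain ⟨a, b, c⟩ := g
  have hQ : (1 : ℤ) ≤ (a ^ 2 + b ^ 2) ^ 2 + 4 * (2 * c - a * b) ^ 2 := by
    by_cases hab : a = 0 ∧ b = 0
    · obtain ⟨rfl, rfl⟩ := hab
      have hc : c ≠ 0 := by
        rintro rfl
        exact hg rfl
      have : 1 ≤ c ^ 2 := by
        rcases lt_or_gt_of_ne hc with h | h <;> nlinarith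
      nlinarith
    · have h1 : 1 ≤ a ^ 2 + b ^ 2 := by
        rcases not_and_or.mp hab with ha | hb
        · have : 1 ≤ a ^ 2 := by rcases lt_or_gt_of_ne ha with h | h <;> nlinarith
          nlinarith [sq_nonneg b]
        · have : 1 ≤ b ^ 2 := by rcases lt_or_gt_of_ne hb with h | h <;> nlinarith
          nlinarith [sq_nonneg a]
      nlinarith [sq_nonneg (2 * c - a * b)]
  have hQR : (1 : ℝ) ≤ quartic (ofInt (a, b, c)) := by
    rw [quartic_ofInt]
    exact_mod_cast hQ
  -- `gauge < 1` would force `gauge⁴ < 1`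
  by_contra hlt
  rw [not_le] at hlt
  have h4 : gauge (ofInt (a, b, c)) ^ 4 < 1 := pow_lt_one₀ (gauge_nonneg _) hlt (by norm_num)
  rw [gauge_pow_four] at h4
  linarith

/-- **`ℍ(ℤ)` is cocompact**: every point of `ℍ` lies within `d_K`-distance `3` of the lattice
(round `x, y` down, then the shifted `z`; the remainder has coordinates in `[0,1)` and quartic
form `≤ 20 ≤ 3⁴`). This is the form used on arXiv p. 6 of [CKN]: "there exist `a, b ∈ ℤ³` such
that `d^ℍ(a,x) ≲ 1` and `d^ℍ(b,y) ≲ 1`". [cite: CheegerKleinerNaor2011, §1.1] -/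
theorem exists_ofInt_dist_le (p : HeisK) : ∃ g : ℤ × ℤ × ℤ, dist (ofInt g) p ≤ 3 := by
  set a : ℤ := ⌊p.x⌋ with ha
  set b : ℤ := ⌊p.y⌋ with hb
  set c : ℤ := ⌊p.z - a * (p.y - b)⌋ with hc
  refine ⟨(a, b, c), ?_⟩
  rw [dist_eq]
  set q : HeisK := (ofInt (a, b, c))⁻¹ * p with hq
  have hqx : q.x = p.x - a := by
    simp only [hq, mul_x, inv_x, ofInt_x]; ring
  have hqy : q.y = p.y - b := by
    simp only [hq, mul_y, inv_y, ofInt_y]; ring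
  have hqz : q.z = p.z - a * (p.y - b) - c := by
    simp only [hq, mul_z, inv_z, inv_x, ofInt_x, ofInt_y, ofInt_z]; ring
  have hx0 : 0 ≤ q.x := by rw [hqx]; linarith [Int.floor_le p.x]
  have hx1 : q.x < 1 := by rw [hqx]; linarith [Int.lt_floor_add_one p.x]
  have hy0 : 0 ≤ q.y := by rw [hqy]; linarith [Int.floor_le p.y]
  have hy1 : q.y < 1 := by rw [hqy]; linarith [Int.lt_floor_add_one p.y]
  have hz0 : 0 ≤ q.z := by rw [hqz]; linarith [Int.floor_le (p.z - a * (p.y - b))]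
  have hz1 : q.z < 1 := by rw [hqz]; linarith [Int.lt_floor_add_one (p.z - a * (p.y - b))]
  have hX2 : q.x ^ 2 ≤ 1 := by nlinarith
  have hY2 : q.y ^ 2 ≤ 1 := by nlinarith
  have hS : (q.x ^ 2 + q.y ^ 2) ^ 2 ≤ 4 := by nlinarith
  have hV1 : 2 * q.z - q.x * q.y ≤ 2 := by nlinarith
  have hV2 : -1 ≤ 2 * q.z - q.x * q.y := by nlinarith
  have hV : (2 * q.z - q.x * q.y) ^ 2 ≤ 4 := by nlinarith
  have hQ : quartic q ≤ 3 ^ 4 := by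
    unfold quartic
    nlinarith
  exact gauge_le_of_quartic_le (by norm_num) hQ

/-! ### The lattice and the word metric: `d_K ≍ d_W` on `ℍ(ℤ)`

The bi-Lipschitz equivalence "by an easy general lemma [BBI]" of [CKN §1.1] between the word
metric `d_W = cayleyGraph.dist` of `HeisenbergL1.lean` and the restriction of the left-invariant
metric of `ℍ` to the lattice, here with the explicit constants `d_K ≤ 3 d_W` and `d_W ≤ 20 d_K`
(from the two-point ball–box bounds `abs_sub_le_dist`, `dist_le_of_abs_sub_le` of
`HeisenbergL1Proofs.lean` and the coordinate bounds `|x|,|y| ≤ ‖p‖_K`, `2|2z−xy| ≤ ‖p‖_K²`). -/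

/-- `ofInt` is a homomorphism from `(ℤ³, heisMul)` to `ℍ`. [cite: CheegerKleinerNaor2011, §1.1] -/
theorem ofInt_heisMul (g h : ℤ × ℤ × ℤ) : ofInt (heisMul g h) = ofInt g * ofInt h :=
  ofInt_mul g h

/-- **`d_K ≤ 3 d_W` on the lattice.** [cite: CheegerKleinerNaor2011, §1.1] -/
theorem dist_ofInt_le (g h : ℤ × ℤ × ℤ) :
    dist (ofInt g) (ofInt h) ≤ 3 * (cayleyGraph.dist g h : ℝ) := by
  obtain ⟨h1, h2, h3⟩ := abs_sub_le_dist g h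
  obtain ⟨x, y, z⟩ := g
  obtain ⟨x', y', z'⟩ := h
  simp only at h1 h2 h3
  rw [dist_eq, ofInt_inv_mul]
  set d : ℕ := cayleyGraph.dist (x, y, z) (x', y', z') with hd
  refine gauge_le_of_quartic_le (by positivity) ?_
  -- integer estimate of the quartic form
  have hx := abs_le.mp h1
  have hy := abs_le.mp h2
  have hw := abs_le.mp h3
  have hx2 : (x' - x) ^ 2 ≤ (d : ℤ) ^ 2 := by nlinarith
  have hy2 : (y' - y) ^ 2 ≤ (d : ℤ) ^ 2 := by nlinarith
  have hS : ((x' - x) ^ 2 + (y' - y) ^ 2) ^ 2 ≤ (2 * (d : ℤ) ^ 2) ^ 2 :=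
    pow_le_pow_left₀ (by positivity) (by linarith) 2
  have hV0 : |2 * (z' - z - x * (y' - y)) - (x' - x) * (y' - y)| ≤ 3 * (d : ℤ) ^ 2 :=
    calc |2 * (z' - z - x * (y' - y)) - (x' - x) * (y' - y)|
        ≤ |2 * (z' - z - x * (y' - y))| + |(x' - x) * (y' - y)| := abs_sub _ _
      _ = 2 * |z' - z - x * (y' - y)| + |x' - x| * |y' - y| := by
          rw [abs_mul, abs_mul, abs_two]
      _ ≤ 2 * (d : ℤ) ^ 2 + (d : ℤ) * d :=
          add_le_add (by linarith) (mul_le_mul h1 h2 (abs_nonneg _) (by positivity))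
      _ = 3 * (d : ℤ) ^ 2 := by ring
  have hV : (2 * (z' - z - x * (y' - y)) - (x' - x) * (y' - y)) ^ 2 ≤ (3 * (d : ℤ) ^ 2) ^ 2 := by
    rw [← sq_abs]
    exact pow_le_pow_left₀ (abs_nonneg _) hV0 2
  have key : ((x' - x) ^ 2 + (y' - y) ^ 2) ^ 2 +
      4 * (2 * (z' - z - x * (y' - y)) - (x' - x) * (y' - y)) ^ 2 ≤ 81 * (d : ℤ) ^ 4 := by
    have hd0 : (0 : ℤ) ≤ (d : ℤ) ^ 4 := by positivity
    nlinarith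
  calc quartic (ofInt (x' - x, y' - y, z' - z - x * (y' - y)))
      = ((((x' - x) ^ 2 + (y' - y) ^ 2) ^ 2 +
          4 * (2 * (z' - z - x * (y' - y)) - (x' - x) * (y' - y)) ^ 2 : ℤ) : ℝ) := by
        rw [quartic_ofInt]
    _ ≤ ((81 * (d : ℤ) ^ 4 : ℤ) : ℝ) := by exact_mod_cast key
    _ = (3 * (d : ℝ)) ^ 4 := by push_cast; ring

/-- **`d_W ≤ 20 d_K` on the lattice.** [cite: CheegerKleinerNaor2011, §1.1] -/
theorem dist_le_dist_ofInt (g h : ℤ × ℤ × ℤ) :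
    (cayleyGraph.dist g h : ℝ) ≤ 20 * dist (ofInt g) (ofInt h) := by
  rcases eq_or_ne g h with rfl | hne
  · simp
  obtain ⟨x, y, z⟩ := g
  obtain ⟨x', y', z'⟩ := h
  rw [dist_eq, ofInt_inv_mul]
  -- the quotient lattice point and its gauge `G ≥ 1`
  set q : HeisK := ofInt (x' - x, y' - y, z' - z - x * (y' - y)) with hq
  have hne' : ((x' - x, y' - y, z' - z - x * (y' - y)) : ℤ × ℤ × ℤ) ≠ (0, 0, 0) := by
    intro e
    simp only [Prod.mk.injEq] at e
    obtain ⟨e1, e2, e3⟩ := e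
    apply hne
    have ex : x' = x := by linarith
    have ey : y' = y := by linarith
    have ez : z' = z := by rw [ey, sub_self, mul_zero, sub_zero] at e3; linarith
    rw [ex, ey, ez]
  have hG1 : 1 ≤ gauge q := one_le_gauge_ofInt hne'
  set G : ℝ := gauge q with hG
  set n : ℕ := ⌈G⌉₊ with hn
  have hGn : G ≤ n := Nat.le_ceil G
  have hn2G : (n : ℝ) ≤ 2 * G := by
    have := Nat.ceil_lt_add_one (by linarith : 0 ≤ G)
    linarith
  -- coordinate bounds from the gauge
  have hqx : q.x = ((x' - x : ℤ) : ℝ) := rfl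
  have hqy : q.y = ((y' - y : ℤ) : ℝ) := rfl
  have hqz : q.z = ((z' - z - x * (y' - y) : ℤ) : ℝ) := rfl
  have hx : |x' - x| ≤ (n : ℤ) := by
    have h := (abs_x_le_gauge q).trans hGn
    rw [hqx, ← Int.cast_abs] at h
    exact_mod_cast h
  have hy : |y' - y| ≤ (n : ℤ) := by
    have h := (abs_y_le_gauge q).trans hGn
    rw [hqy, ← Int.cast_abs] at h
    exact_mod_cast h
  have hw : |z' - z - x * (y' - y)| ≤ (n : ℤ) ^ 2 := by
    have h1 := abs_vert_le_gauge_sq q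
    have h2 := abs_x_le_gauge q
    have h3 := abs_y_le_gauge q
    have hxy : |q.x * q.y| ≤ G * G := by
      rw [abs_mul]
      exact mul_le_mul h2 h3 (abs_nonneg _) (by linarith)
    have h4 := abs_sub_abs_le_abs_sub (2 * q.z) (q.x * q.y)
    rw [abs_mul, abs_two] at h4
    have h5 : |q.z| ≤ G ^ 2 := by nlinarith
    have h6 : |q.z| ≤ (n : ℝ) ^ 2 := h5.trans (pow_le_pow_left₀ (by linarith) hGn 2)
    rw [hqz, ← Int.cast_abs] at h6
    exact_mod_cast h6
  have hdist : cayleyGraph.dist (x, y, z) (x', y', z') ≤ 10 * n := dist_le_of_abs_sub_le hx hy hw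
  calc (cayleyGraph.dist (x, y, z) (x', y', z') : ℝ) ≤ 10 * n := by exact_mod_cast hdist
    _ ≤ 10 * (2 * G) := by linarith
    _ = 20 * G := by ring

/-! ### Relation to the Euclidean-metric copy `Literature.NumberTheory.Sieve.Heis` -/

/-- The lattice points of `HeisK` are the lattice `Heis.latticeΓ = H³(ℤ)` of the nilmanifold
file. [cite: CheegerKleinerNaor2011, §1.1] -/
theorem toHeis_ofInt_mem_latticeΓ (g : ℤ × ℤ × ℤ) :
    toHeis (ofInt g) ∈ _root_.Literature.NumberTheory.Sieve.Heis.latticeΓ :=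
  _root_.Literature.NumberTheory.Sieve.Heis.mk_int_mem _ _ _

/-- The identity `HeisK → Heis` is continuous (from the Cygan–Korányi to the Euclidean
topology). [cite: Cygan1981, p. 69] -/
theorem continuous_toHeis : Continuous toHeis :=
  _root_.Literature.NumberTheory.Sieve.Heis.continuous_mk lipschitzWith_x.continuous
    lipschitzWith_y.continuous continuous_z

/-- The identity `Heis → HeisK` is continuous (from the Euclidean to the Cygan–Korányi
topology). [cite: Cygan1981, p. 69] -/
theorem continuous_toHeis_symm : Continuous toHeis.symm := by
  have e : (fun g => toHeis.symm g) = equivProd.symm ∘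
      fun g : _root_.Literature.NumberTheory.Sieve.Heis => (g.x, g.y, g.z) := by
    funext g
    rfl
  rw [show (toHeis.symm : _root_.Literature.NumberTheory.Sieve.Heis → HeisK) =
    fun g => toHeis.symm g from rfl, e]
  exact continuous_equivProd_symm.comp
    (_root_.Literature.NumberTheory.Sieve.Heis.continuous_x.prodMk
      (_root_.Literature.NumberTheory.Sieve.Heis.continuous_y.prodMk
        _root_.Literature.NumberTheory.Sieve.Heis.continuous_z))

/-- **The Cygan–Korányi and Euclidean topologies on `ℍ` coincide**: the identity is a
homeomorphism `HeisK ≃ₜ Heis`. [cite: CheegerKleinerNaor2011, §1.1] -/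
def toHeisHomeomorph : HeisK ≃ₜ _root_.Literature.NumberTheory.Sieve.Heis where
  toEquiv := toHeis.toEquiv
  continuous_toFun := continuous_toHeis
  continuous_invFun := continuous_toHeis_symm

end HeisK

end Literature.Geometry.MetricEmbeddings

end
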